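import Summits.HodgeConjecture.HodgeConjecture.Theorems.F0P2dStubREngine
import HarnessLib

/-!
# Crux `H413`, (D) desk sub-line `F0_P2SpectralProjectionD` — stub (R) `stub_R_regularOfReproduced`: REGULARITY OF REPRODUCED CLASSES

Cell hodgecm-mathlib (D-0151), FLOOR 0, crux item H413 = stmt-HodgeConjecture-24833; programme P2, sub-line of record
`Cruxes/H413/Lines/F0_P2SpectralProjectionD.lean` v1.2 (F0P2-plan (g2), road (h) of `F0/P2/CENSUS-R.v2`), registered stub **(R)
`stub_R_regularOfReproduced : StubRRegularOfReproduced`** (:257 ∕ :329 of v1.1; assigned to F0P2-p04 (g2), bus 2026-08-31T00:03:40Z ∕ 00:05:18Z).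
THEOREMS ONLY; `--supports stmt-HodgeConjecture-24833 --as helper`.  HC_CM is proved only modulo the 7 printed citations until rung 0 closes;
this file proves nothing about them.

THE STATEMENT (`stubR_holds`; the Lines-local bundles `IsRegularKernel` ∕ `kernelOp` ∕ `probeP` ∕ `orbitP` ∕ `Realises` ∕ `G3` UNFOLDED into
their fields — a `Theorems/` file cannot import a `Cruxes/…/Lines/` module): in the engine setting (`L` CM, `[L⁺:ℚ] ≥ 2`, `H` of signature
`(2,1)` at `ι` with frame `T`, positive definite at the other places, `μ` automorphic, `ν` Haar on `U(2,1)`), for a continuous compactly supported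
matrix kernel `A` on `U(2,1)` that is `C¹` along the left `𝔭`-probes with jointly continuous probe derivative, a pair `w` of `L²` classes that is
REPRODUCED (`w_j = Σ_i ∫ A(u)_{ji} • R(ιinf u) w_i dν`), right `K_c`-invariant and right invariant under an open `K_f`, there are
`Ψ_j : U(H)(𝔸) → ℂ` with: (R1) left `A_G·G(K)`-invariance, (R2) CONTINUITY on `U(H)(𝔸)`, (R3) `toQuotFun Ψ_j = w_j` a.e., (R4) differentiable
`𝔭`-probes `b ↦ Ψ_j(y ιinf(exp X_b))` at `0` for every `y`, (R5) probe derivatives continuous in `y`, (R6) probe derivatives REPRESENTING the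
`L²`-derivative of the `𝔭`-orbit map `b ↦ R(ιinf exp X_b) w_j` at `0`.

THE PROOF (road (h) steps h3 + h4; no Sobolev, no `(𝔤,K)`-theory): shrink `K_f` to the compact open `K_f ⊓ K_f⁰` (★ `finAdelicIntegralLevel`);
take EXACTLY `K_c K_f`-invariant representatives `w̄_i` (companion `F0P2dStubREngine.exists_invariant_representative`); put
**`Ψ_j(x) := Σ_i ∫ A(u)_{ji} w̄_i(x ιinf(u)) dν(u)`** (`w̄_i` read on the group through `invQuot`).  Every base point is good (companion §2), so:
(R1) ★ `orbitalIntegral_mul_left`; (R2) companion `continuous_orbitalIntegral_of_invariant`; (R3) the reproduction hypothesis and the Fubini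
representative ★ `coeFn_integral_smul_rightRegular_toLp_eq_orbitalIntegral`; (R4)∕(R5) ★ `hasFDerivAt_orbitalIntegral_expP` ∕
`fderiv_orbitalIntegral_expP_apply` (differentiation under the integral along `b ↦ (exp X_b)⁻¹ u`, ★ `AutomorphicFormsL2OrbitalSmoothingU21`) — the
probe derivative in direction `b` is `Σ_i ∫ (∂_b A_{ji})(u) w̄_i(x ιinf u) dν`, again an orbital integral of the `w̄_i` against a continuous compactly
supported kernel, hence continuous by (R2)'s lemma; (R6) in `L²`, `R(ιinf exp X_b) w_j = Σ_i ∫ A((exp X_b)⁻¹u)_{ji} • R(ιinf u) w_i dν` is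
differentiated under the Bochner integral (★ `hasFDerivAt_rightRegular_expP_integral_smul`), giving the class `Σ_i ∫ (∂_b A_{ji})(u) • R(ιinf u) w_i dν`,
whose pointwise representative is the probe derivative (two Fubini representatives — no uniform-continuity argument).

* `psi_mul_left`, `continuous_psi`, `toQuotFun_psi_ae_eq`, `hasFDerivAt_probe_psi`, `fderiv_probe_psi_apply`, `continuous_fderiv_probe_psi`,
  `fderiv_orbit_apply`, `toQuotFun_fderiv_probe_psi_ae_eq` — (R1)–(R6) for the explicit `Ψ_j`;
* **`stubR_holds`** — the stub with unfolded bundles.  Registrar's fold (checked by paste against the v1.2 bytes of the bundles, axioms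
  `[propext, Classical.choice, Quot.sound]`):
  `stub_R_regularOfReproduced := fun L _ _ _ ι H T hT hdef hrk μ _ ν _ A hA w hrep hkc hkf => by
    obtain ⟨Ψ, h⟩ := F0P2dStubR.stubR_holds L ι H T hT hdef hrk μ ν A hA.cont hA.supp hA.diff hA.contDeriv w hrep hkc hkf
    exact ⟨Ψ, fun j => ⟨(h j).1, (h j).2.1, (h j).2.2.1, (h j).2.2.2.1, (h j).2.2.2.2.1, (h j).2.2.2.2.2⟩⟩`.

## References
* [Borel1997] A. Borel, *Automorphic forms on SL₂(ℝ)*, Cambridge Tracts 130 (1997), Thm. 2.13–2.14 and §8.4 (regularity of `f ∗ α`;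
  derivatives `f ∗ Xα`), §5.14.  [HarishChandra1966] Harish-Chandra, Acta Math. 116 (1966), §8 (`φ = φ ∗ α`).
* [BorelJacquet1979] A. Borel, H. Jacquet, Corvallis PSPM 33.1 (1979), §4.1–4.2, §4.6.  [HarishChandra1968] LNM 62, §I.2.
-/

set_option autoImplicit false

-- the mandated namespace has the single-problem summit's repeated segment (`HodgeConjecture.HodgeConjecture`)
set_option linter.dupNamespace false

noncomputable section

namespace Summit.HodgeConjecture.HodgeConjecture.Cruxes.H413.F0P2dStubR

open scoped Topology ENNReal Pointwise Matrix ComplexOrder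
open MeasureTheory NumberField Set Filter Function
open Literature.NumberTheory.Automorphic Literature.NumberTheory.Automorphic.UnitaryGroup
open Literature.NumberTheory.Automorphic.UnitaryGroup.CotangentForms
open Literature.NumberTheory.Automorphic.OrbitalSmoothingU21
open Literature.AlgebraicGeometry.ShimuraVarieties
open Literature.Geometry.ComplexHyperbolic.BallModel (U21)

/-! ## §3 The representative `Ψ_j(x) = Σ_i ∫ A(u)_{ji} w̄_i(x ιinf(u)) dν(u)` and its six `Realises` properties -/

section Assembly

variable (L : Type) [Field L] [NumberField L] [IsCMField L] (ι : L →+* ℂ) (H : Matrix (Fin 3) (Fin 3) L)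
  (T : GL (Fin 3) ℂ)
  (hT : (T : Matrix (Fin 3) (Fin 3) ℂ)ᴴ * H.map ι * (T : Matrix (Fin 3) (Fin 3) ℂ) = Literature.Geometry.ComplexHyperbolic.BallModel.J)


/-- Entries of a continuous matrix kernel are continuous. [cite: Borel1997, §2.13] -/
theorem continuous_entry {A : U21 → Matrix (Fin 2) (Fin 2) ℂ} (hAc : Continuous A) (j i : Fin 2) :
    Continuous fun u : U21 ↦ A u j i :=
  hAc.matrix_elem j i

/-- Entries of a compactly supported matrix kernel are compactly supported. [cite: Borel1997, §2.13] -/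
theorem hasCompactSupport_entry {A : U21 → Matrix (Fin 2) (Fin 2) ℂ} (hAs : HasCompactSupport A) (j i : Fin 2) :
    HasCompactSupport fun u : U21 ↦ A u j i :=
  hAs.mono fun u hu ↦ by
    intro h0
    refine hu ?_
    show A u j i = 0
    rw [h0, Matrix.zero_apply]

variable (μ : Measure (adelicGroupData (↥(maximalRealSubfield L)) L (IsCMField.complexConj L) 3 H).automorphicQuotient)
  [(adelicGroupData (↥(maximalRealSubfield L)) L (IsCMField.complexConj L) 3 H).IsAutomorphicMeasure μ]
  (ν : Measure U21) [ν.IsHaarMeasure] (A : U21 → Matrix (Fin 2) (Fin 2) ℂ)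
  (F : Fin 2 → (adelicGroupData (↥(maximalRealSubfield L)) L (IsCMField.complexConj L) 3 H).automorphicQuotient → ℂ) (j : Fin 2)

omit [ν.IsHaarMeasure] in
/-- (R1) **`Ψ_j` is left-`A_G · G(K)`-invariant** (at every point). [cite: BorelJacquet1979, §4.2] -/
theorem psi_mul_left {γ : (adelicGroupData (↥(maximalRealSubfield L)) L (IsCMField.complexConj L) 3 H).Adelic} (hγ : γ ∈ (adelicGroupData (↥(maximalRealSubfield L)) L (IsCMField.complexConj L) 3 H).quotientSubgroup) (x : (adelicGroupData (↥(maximalRealSubfield L)) L (IsCMField.complexConj L) 3 H).Adelic) :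
    (∑ i : Fin 2, ∫ u, A u j i * invQuot (adelicGroupData (↥(maximalRealSubfield L)) L (IsCMField.complexConj L) 3 H) (F i) (γ * x * cmArchSection L ι H T hT u) ∂ν) =
      ∑ i : Fin 2, ∫ u, A u j i * invQuot (adelicGroupData (↥(maximalRealSubfield L)) L (IsCMField.complexConj L) 3 H) (F i) (x * cmArchSection L ι H T hT u) ∂ν :=
  Finset.sum_congr rfl fun i _ ↦ (adelicGroupData (↥(maximalRealSubfield L)) L (IsCMField.complexConj L) 3 H).orbitalIntegral_mul_left ν (fun u ↦ A u j i) (F i) hγ x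

/-- (R2) **`Ψ_j` is continuous on `U(H)(𝔸)`** (h4). [cite: Borel1997, Thm. 2.13 and §8.4] -/
theorem continuous_psi (hAc : Continuous A) (hAs : HasCompactSupport A)
    {Kf : Subgroup (finAdelic (↥(maximalRealSubfield L)) L (IsCMField.complexConj L) 3 H)}
    (hKfo : IsOpen (Kf : Set (finAdelic (↥(maximalRealSubfield L)) L (IsCMField.complexConj L) 3 H)))
    (hgood : ∀ (i : Fin 2) (x : (adelicGroupData (↥(maximalRealSubfield L)) L (IsCMField.complexConj L) 3 H).Adelic), LocallyIntegrable (fun u : U21 ↦ invQuot (adelicGroupData (↥(maximalRealSubfield L)) L (IsCMField.complexConj L) 3 H) (F i) (x * cmArchSection L ι H T hT u)) ν)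
    (hFc : ∀ i, ∀ k ∈ cmCompactFactor L ι H T hT, ∀ ξ, F i (k • ξ) = F i ξ) (hFf : ∀ i, ∀ k ∈ Kf, ∀ ξ, F i ((finAdelicToAdelic (↥(maximalRealSubfield L)) L (IsCMField.complexConj L) 3 H) k • ξ) = F i ξ) :
    Continuous fun x : (adelicGroupData (↥(maximalRealSubfield L)) L (IsCMField.complexConj L) 3 H).Adelic ↦ ∑ i : Fin 2, ∫ u, A u j i * invQuot (adelicGroupData (↥(maximalRealSubfield L)) L (IsCMField.complexConj L) 3 H) (F i) (x * cmArchSection L ι H T hT u) ∂ν :=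
  continuous_finsetSum _ fun i _ ↦ continuous_orbitalIntegral_of_invariant L ι H T hT ν hKfo (hgood i) (hFc i) (hFf i)
    (continuous_entry hAc j i) (hasCompactSupport_entry hAs j i)

/-- (R3) **The class of `Ψ_j` is `w_j`**: `toQuotFun Ψ_j = w_j` a.e., from the reproduction `w_j = Σ_i ∫ A(u)_{ji} • R(ιinf u) w_i dν`
and the Fubini representative of each smoothed class (★ `coeFn_integral_smul_rightRegular_toLp_eq_orbitalIntegral`).
[cite: BorelJacquet1979, §4.6] [cite: Borel1997, Thm. 2.13] -/
theorem toQuotFun_psi_ae_eq (hAc : Continuous A) (hAs : HasCompactSupport A) (w : Fin 2 → (adelicGroupData (↥(maximalRealSubfield L)) L (IsCMField.complexConj L) 3 H).L2 μ)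
    (hFmem : ∀ i, MemLp (F i) 2 μ) (hFw : ∀ i, (hFmem i).toLp (F i) = w i)
    (hrep : (∑ i : Fin 2, ∫ u, A u j i • (adelicGroupData (↥(maximalRealSubfield L)) L (IsCMField.complexConj L) 3 H).rightRegular μ (cmArchSection L ι H T hT u) (w i) ∂ν) = w j) :
    toQuotFun (adelicGroupData (↥(maximalRealSubfield L)) L (IsCMField.complexConj L) 3 H) (fun x ↦ ∑ i : Fin 2, ∫ u, A u j i * invQuot (adelicGroupData (↥(maximalRealSubfield L)) L (IsCMField.complexConj L) 3 H) (F i) (x * cmArchSection L ι H T hT u) ∂ν) =ᵐ[μ]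
      ((w j : (adelicGroupData (↥(maximalRealSubfield L)) L (IsCMField.complexConj L) 3 H).L2 μ) : (adelicGroupData (↥(maximalRealSubfield L)) L (IsCMField.complexConj L) 3 H).automorphicQuotient → ℂ) := by
  have hι : Continuous (cmArchSection L ι H T hT) := continuous_archSectionU21CM L ι H T hT
  have hleft : ∀ γ ∈ (adelicGroupData (↥(maximalRealSubfield L)) L (IsCMField.complexConj L) 3 H).quotientSubgroup, ∀ x,
      (fun x ↦ ∑ i : Fin 2, ∫ u, A u j i * invQuot (adelicGroupData (↥(maximalRealSubfield L)) L (IsCMField.complexConj L) 3 H) (F i) (x * cmArchSection L ι H T hT u) ∂ν) (γ * x) =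
        (fun x ↦ ∑ i : Fin 2, ∫ u, A u j i * invQuot (adelicGroupData (↥(maximalRealSubfield L)) L (IsCMField.complexConj L) 3 H) (F i) (x * cmArchSection L ι H T hT u) ∂ν) x :=
    fun γ hγ x ↦ psi_mul_left L ι H T hT ν A F j hγ x
  set Tm : Fin 2 → (adelicGroupData (↥(maximalRealSubfield L)) L (IsCMField.complexConj L) 3 H).L2 μ := fun i ↦ ∫ u, A u j i • (adelicGroupData (↥(maximalRealSubfield L)) L (IsCMField.complexConj L) 3 H).rightRegular μ (cmArchSection L ι H T hT u) (w i) ∂ν with hTm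
  have hcls : ∀ i : Fin 2, ∀ᵐ y ∂μ, ∀ g : (adelicGroupData (↥(maximalRealSubfield L)) L (IsCMField.complexConj L) 3 H).Adelic, (adelicGroupData (↥(maximalRealSubfield L)) L (IsCMField.complexConj L) 3 H).toAutomorphicQuotient g = y →
      ((Tm i : (adelicGroupData (↥(maximalRealSubfield L)) L (IsCMField.complexConj L) 3 H).L2 μ) : (adelicGroupData (↥(maximalRealSubfield L)) L (IsCMField.complexConj L) 3 H).automorphicQuotient → ℂ) y =
        ∫ u, A u j i * invQuot (adelicGroupData (↥(maximalRealSubfield L)) L (IsCMField.complexConj L) 3 H) (F i) (g⁻¹ * cmArchSection L ι H T hT u) ∂ν := by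
    intro i
    have h := (adelicGroupData (↥(maximalRealSubfield L)) L (IsCMField.complexConj L) 3 H).coeFn_integral_smul_rightRegular_toLp_eq_orbitalIntegral μ ν hι (continuous_entry hAc j i)
      (hasCompactSupport_entry hAs j i) (hFmem i)
    rw [hFw i] at h
    exact h
  have hsum : w j = Tm 0 + Tm 1 := by rw [← hrep, Fin.sum_univ_two]
  filter_upwards [hcls 0, hcls 1, Lp.coeFn_add (Tm 0) (Tm 1)] with y h0 h1 hadd
  obtain ⟨g, rfl⟩ : ∃ g, (adelicGroupData (↥(maximalRealSubfield L)) L (IsCMField.complexConj L) 3 H).toAutomorphicQuotient g = y := QuotientGroup.mk_surjective y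
  rw [toQuotFun_mk hleft g, hsum, hadd, Pi.add_apply, h0 g rfl, h1 g rfl, Fin.sum_univ_two]

/-- (R4) **The `𝔭`-probes of `Ψ_j` are differentiable**, with derivative the sum of the pointwise derivative integrals (★
`hasFDerivAt_orbitalIntegral_expP`, at every good base point — here every base point). [cite: Borel1997, Thm. 2.13] -/
theorem hasFDerivAt_probe_psi (hAc : Continuous A) (hAs : HasCompactSupport A)
    (hAd : ∀ (j i : Fin 2) (u' : U21), ContDiff ℝ 1 fun b : Fin 2 → ℂ ↦ A (BallForms.expP b * u') j i)
    (hAD : ∀ j i : Fin 2, Continuous fun p : (Fin 2 → ℂ) × U21 ↦ fderiv ℝ (fun b : Fin 2 → ℂ ↦ A (BallForms.expP b * p.2) j i) p.1)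
    (hgood : ∀ (i : Fin 2) (x : (adelicGroupData (↥(maximalRealSubfield L)) L (IsCMField.complexConj L) 3 H).Adelic), LocallyIntegrable (fun u : U21 ↦ invQuot (adelicGroupData (↥(maximalRealSubfield L)) L (IsCMField.complexConj L) 3 H) (F i) (x * cmArchSection L ι H T hT u)) ν)
    (y : (adelicGroupData (↥(maximalRealSubfield L)) L (IsCMField.complexConj L) 3 H).Adelic) (b₀ : Fin 2 → ℂ) :
    HasFDerivAt (fun b : Fin 2 → ℂ ↦ ∑ i : Fin 2, ∫ u, A u j i * invQuot (adelicGroupData (↥(maximalRealSubfield L)) L (IsCMField.complexConj L) 3 H) (F i)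
        (y * cmArchSection L ι H T hT (BallForms.expP b) * cmArchSection L ι H T hT u) ∂ν)
      (∑ i : Fin 2, ∫ u, invQuot (adelicGroupData (↥(maximalRealSubfield L)) L (IsCMField.complexConj L) 3 H) (F i) (y * cmArchSection L ι H T hT u) •
        fderiv ℝ (fun b' : Fin 2 → ℂ ↦ A ((BallForms.expP b')⁻¹ * u) j i) b₀ ∂ν) b₀ := by
  refine HasFDerivAt.fun_sum fun i _ ↦ ?_
  exact (adelicGroupData (↥(maximalRealSubfield L)) L (IsCMField.complexConj L) 3 H).hasFDerivAt_orbitalIntegral_expP ν (continuous_entry hAc j i) (hasCompactSupport_entry hAs j i) (hAd j i)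
    (hAD j i) (F i) (hgood i y) b₀

/-- (R4′) **The probe derivative of `Ψ_j`, evaluated**: `∂_b|_{b₀} Ψ_j(y ιinf(exp X_b)) · v = Σ_i ∫ (D_b|_{b₀} A((exp X_b)⁻¹u)_{ji} · v) w̄_i(y ιinf u) dν`
— again a sum of orbital integrals of the `w̄_i`, against the derivative kernels. [cite: Borel1997, Thm. 2.13] -/
theorem fderiv_probe_psi_apply (hAc : Continuous A) (hAs : HasCompactSupport A)
    (hAd : ∀ (j i : Fin 2) (u' : U21), ContDiff ℝ 1 fun b : Fin 2 → ℂ ↦ A (BallForms.expP b * u') j i)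
    (hAD : ∀ j i : Fin 2, Continuous fun p : (Fin 2 → ℂ) × U21 ↦ fderiv ℝ (fun b : Fin 2 → ℂ ↦ A (BallForms.expP b * p.2) j i) p.1)
    (hgood : ∀ (i : Fin 2) (x : (adelicGroupData (↥(maximalRealSubfield L)) L (IsCMField.complexConj L) 3 H).Adelic), LocallyIntegrable (fun u : U21 ↦ invQuot (adelicGroupData (↥(maximalRealSubfield L)) L (IsCMField.complexConj L) 3 H) (F i) (x * cmArchSection L ι H T hT u)) ν)
    (y : (adelicGroupData (↥(maximalRealSubfield L)) L (IsCMField.complexConj L) 3 H).Adelic) (b₀ v : Fin 2 → ℂ) :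
    fderiv ℝ (fun b : Fin 2 → ℂ ↦ ∑ i : Fin 2, ∫ u, A u j i * invQuot (adelicGroupData (↥(maximalRealSubfield L)) L (IsCMField.complexConj L) 3 H) (F i)
        (y * cmArchSection L ι H T hT (BallForms.expP b) * cmArchSection L ι H T hT u) ∂ν) b₀ v =
      ∑ i : Fin 2, ∫ u, fderiv ℝ (fun b' : Fin 2 → ℂ ↦ A ((BallForms.expP b')⁻¹ * u) j i) b₀ v *
        invQuot (adelicGroupData (↥(maximalRealSubfield L)) L (IsCMField.complexConj L) 3 H) (F i) (y * cmArchSection L ι H T hT u) ∂ν := by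
  rw [(hasFDerivAt_probe_psi L ι H T hT ν A F j hAc hAs hAd hAD hgood y b₀).fderiv, _root_.sum_apply]
  refine Finset.sum_congr rfl fun i _ ↦ ?_
  rw [← ((adelicGroupData (↥(maximalRealSubfield L)) L (IsCMField.complexConj L) 3 H).hasFDerivAt_orbitalIntegral_expP ν (continuous_entry hAc j i) (hasCompactSupport_entry hAs j i) (hAd j i)
    (hAD j i) (F i) (hgood i y) b₀).fderiv]
  exact (adelicGroupData (↥(maximalRealSubfield L)) L (IsCMField.complexConj L) 3 H).fderiv_orbitalIntegral_expP_apply ν (continuous_entry hAc j i) (hasCompactSupport_entry hAs j i) (hAd j i)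
    (hAD j i) (F i) (hgood i y) b₀ v

/-- (R5) **The probe derivatives are continuous in the base point** (they are orbital integrals of the exactly invariant `w̄_i` against
the continuous compactly supported derivative kernels, so (R2) applies). [cite: Borel1997, Thm. 2.13 and §8.4] -/
theorem continuous_fderiv_probe_psi (hAc : Continuous A) (hAs : HasCompactSupport A)
    (hAd : ∀ (j i : Fin 2) (u' : U21), ContDiff ℝ 1 fun b : Fin 2 → ℂ ↦ A (BallForms.expP b * u') j i)
    (hAD : ∀ j i : Fin 2, Continuous fun p : (Fin 2 → ℂ) × U21 ↦ fderiv ℝ (fun b : Fin 2 → ℂ ↦ A (BallForms.expP b * p.2) j i) p.1)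
    {Kf : Subgroup (finAdelic (↥(maximalRealSubfield L)) L (IsCMField.complexConj L) 3 H)}
    (hKfo : IsOpen (Kf : Set (finAdelic (↥(maximalRealSubfield L)) L (IsCMField.complexConj L) 3 H)))
    (hgood : ∀ (i : Fin 2) (x : (adelicGroupData (↥(maximalRealSubfield L)) L (IsCMField.complexConj L) 3 H).Adelic), LocallyIntegrable (fun u : U21 ↦ invQuot (adelicGroupData (↥(maximalRealSubfield L)) L (IsCMField.complexConj L) 3 H) (F i) (x * cmArchSection L ι H T hT u)) ν)
    (hFc : ∀ i, ∀ k ∈ cmCompactFactor L ι H T hT, ∀ ξ, F i (k • ξ) = F i ξ) (hFf : ∀ i, ∀ k ∈ Kf, ∀ ξ, F i ((finAdelicToAdelic (↥(maximalRealSubfield L)) L (IsCMField.complexConj L) 3 H) k • ξ) = F i ξ)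
    (b : Fin 2 → ℂ) :
    Continuous fun y : (adelicGroupData (↥(maximalRealSubfield L)) L (IsCMField.complexConj L) 3 H).Adelic ↦ fderiv ℝ (fun b' : Fin 2 → ℂ ↦ ∑ i : Fin 2, ∫ u, A u j i * invQuot (adelicGroupData (↥(maximalRealSubfield L)) L (IsCMField.complexConj L) 3 H) (F i)
        (y * cmArchSection L ι H T hT (BallForms.expP b') * cmArchSection L ι H T hT u) ∂ν) 0 b := by
  have h : Continuous fun y : (adelicGroupData (↥(maximalRealSubfield L)) L (IsCMField.complexConj L) 3 H).Adelic ↦ ∑ i : Fin 2, ∫ u, fderiv ℝ (fun b' : Fin 2 → ℂ ↦ A ((BallForms.expP b')⁻¹ * u) j i) 0 b *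
      invQuot (adelicGroupData (↥(maximalRealSubfield L)) L (IsCMField.complexConj L) 3 H) (F i) (y * cmArchSection L ι H T hT u) ∂ν :=
    continuous_finsetSum _ fun i _ ↦ continuous_orbitalIntegral_of_invariant L ι H T hT ν hKfo (hgood i) (hFc i) (hFf i)
      (continuous_fderiv_comp_expP_inv_mul_apply (α := fun u ↦ A u j i) (hAd j i) (hAD j i) 0 b)
      (hasCompactSupport_fderiv_comp_expP_inv_mul_apply (α := fun u ↦ A u j i) (hasCompactSupport_entry hAs j i) 0 b)
  exact h.congr fun y ↦ (fderiv_probe_psi_apply L ι H T hT ν A F j hAc hAs hAd hAD hgood y 0 b).symm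

/-- (R6, `L²` side) **The `𝔭`-orbit map of the reproduced class `w_j` is differentiable at `0`**, with derivative in direction `b` the
sum of the classes smoothed by the derivative kernels: `∂_b|_0 R(ιinf exp X_b) w_j · b = Σ_i ∫ (∂_b|_0 A((exp X_b)⁻¹ u)_{ji} · b) • R(ιinf u) w_i dν`
(★ `hasFDerivAt_rightRegular_expP_integral_smul`, `fderiv_rightRegular_expP_integral_smul_apply`). [cite: HarishChandra1966, §8] [cite: Borel1997, Thm. 2.13] -/
theorem fderiv_orbit_apply (hAc : Continuous A) (hAs : HasCompactSupport A)
    (hAd : ∀ (j i : Fin 2) (u' : U21), ContDiff ℝ 1 fun b : Fin 2 → ℂ ↦ A (BallForms.expP b * u') j i)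
    (hAD : ∀ j i : Fin 2, Continuous fun p : (Fin 2 → ℂ) × U21 ↦ fderiv ℝ (fun b : Fin 2 → ℂ ↦ A (BallForms.expP b * p.2) j i) p.1)
    (w : Fin 2 → (adelicGroupData (↥(maximalRealSubfield L)) L (IsCMField.complexConj L) 3 H).L2 μ)
    (hrep : (∑ i : Fin 2, ∫ u, A u j i • (adelicGroupData (↥(maximalRealSubfield L)) L (IsCMField.complexConj L) 3 H).rightRegular μ (cmArchSection L ι H T hT u) (w i) ∂ν) = w j) (b : Fin 2 → ℂ) :
    fderiv ℝ (fun b' : Fin 2 → ℂ ↦ (adelicGroupData (↥(maximalRealSubfield L)) L (IsCMField.complexConj L) 3 H).rightRegular μ (cmArchSection L ι H T hT (BallForms.expP b')) (w j)) 0 b =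
      ∑ i : Fin 2, ∫ u, fderiv ℝ (fun b' : Fin 2 → ℂ ↦ A ((BallForms.expP b')⁻¹ * u) j i) 0 b •
        (adelicGroupData (↥(maximalRealSubfield L)) L (IsCMField.complexConj L) 3 H).rightRegular μ (cmArchSection L ι H T hT u) (w i) ∂ν := by
  have hι : Continuous (cmArchSection L ι H T hT) := continuous_archSectionU21CM L ι H T hT
  have horb : (fun b' : Fin 2 → ℂ ↦ (adelicGroupData (↥(maximalRealSubfield L)) L (IsCMField.complexConj L) 3 H).rightRegular μ (cmArchSection L ι H T hT (BallForms.expP b')) (w j)) =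
      fun b' ↦ ∑ i : Fin 2, (adelicGroupData (↥(maximalRealSubfield L)) L (IsCMField.complexConj L) 3 H).rightRegular μ (cmArchSection L ι H T hT (BallForms.expP b'))
        (∫ u, A u j i • (adelicGroupData (↥(maximalRealSubfield L)) L (IsCMField.complexConj L) 3 H).rightRegular μ (cmArchSection L ι H T hT u) (w i) ∂ν) := by
    funext b'
    rw [← hrep, map_sum]
  have hD : ∀ i : Fin 2, HasFDerivAt (fun b' : Fin 2 → ℂ ↦ (adelicGroupData (↥(maximalRealSubfield L)) L (IsCMField.complexConj L) 3 H).rightRegular μ (cmArchSection L ι H T hT (BallForms.expP b'))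
        (∫ u, A u j i • (adelicGroupData (↥(maximalRealSubfield L)) L (IsCMField.complexConj L) 3 H).rightRegular μ (cmArchSection L ι H T hT u) (w i) ∂ν))
      (∫ u, (fderiv ℝ (fun b' : Fin 2 → ℂ ↦ A ((BallForms.expP b')⁻¹ * u) j i) 0).smulRight
        ((adelicGroupData (↥(maximalRealSubfield L)) L (IsCMField.complexConj L) 3 H).rightRegular μ (cmArchSection L ι H T hT u) (w i)) ∂ν) 0 := fun i ↦
    (adelicGroupData (↥(maximalRealSubfield L)) L (IsCMField.complexConj L) 3 H).hasFDerivAt_rightRegular_expP_integral_smul μ ν hι (continuous_entry hAc j i) (hasCompactSupport_entry hAs j i)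
      (hAd j i) (hAD j i) (w i)
  rw [horb, (HasFDerivAt.fun_sum fun i _ ↦ hD i).fderiv, _root_.sum_apply]
  refine Finset.sum_congr rfl fun i _ ↦ ?_
  rw [← (hD i).fderiv]
  exact (adelicGroupData (↥(maximalRealSubfield L)) L (IsCMField.complexConj L) 3 H).fderiv_rightRegular_expP_integral_smul_apply μ ν hι (continuous_entry hAc j i) (hasCompactSupport_entry hAs j i)
    (hAd j i) (hAD j i) (w i) b

/-- (R6) **The probe derivatives REPRESENT the `L²`-derivatives**: `toQuotFun (y ↦ ∂_b|_0 Ψ_j(y ιinf(exp X_b)) · b)` agrees a.e. with the class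
`∂_b|_0 R(ιinf exp X_b) w_j · b` — both are the sum over `i` of «`w_i` smoothed by the derivative kernel `u ↦ ∂A_{ji} · b`», read pointwise
resp. in `L²` (two Fubini representatives; ★ `coeFn_integral_smul_rightRegular_toLp_eq_orbitalIntegral`). [cite: HarishChandra1966, §8] [cite: Borel1997, Thm. 2.13] -/
theorem toQuotFun_fderiv_probe_psi_ae_eq (hAc : Continuous A) (hAs : HasCompactSupport A)
    (hAd : ∀ (j i : Fin 2) (u' : U21), ContDiff ℝ 1 fun b : Fin 2 → ℂ ↦ A (BallForms.expP b * u') j i)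
    (hAD : ∀ j i : Fin 2, Continuous fun p : (Fin 2 → ℂ) × U21 ↦ fderiv ℝ (fun b : Fin 2 → ℂ ↦ A (BallForms.expP b * p.2) j i) p.1)
    (w : Fin 2 → (adelicGroupData (↥(maximalRealSubfield L)) L (IsCMField.complexConj L) 3 H).L2 μ) (hFmem : ∀ i, MemLp (F i) 2 μ) (hFw : ∀ i, (hFmem i).toLp (F i) = w i)
    (hrep : (∑ i : Fin 2, ∫ u, A u j i • (adelicGroupData (↥(maximalRealSubfield L)) L (IsCMField.complexConj L) 3 H).rightRegular μ (cmArchSection L ι H T hT u) (w i) ∂ν) = w j)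
    (hgood : ∀ (i : Fin 2) (x : (adelicGroupData (↥(maximalRealSubfield L)) L (IsCMField.complexConj L) 3 H).Adelic), LocallyIntegrable (fun u : U21 ↦ invQuot (adelicGroupData (↥(maximalRealSubfield L)) L (IsCMField.complexConj L) 3 H) (F i) (x * cmArchSection L ι H T hT u)) ν)
    (b : Fin 2 → ℂ) :
    toQuotFun (adelicGroupData (↥(maximalRealSubfield L)) L (IsCMField.complexConj L) 3 H) (fun y ↦ fderiv ℝ (fun b' : Fin 2 → ℂ ↦ ∑ i : Fin 2, ∫ u, A u j i * invQuot (adelicGroupData (↥(maximalRealSubfield L)) L (IsCMField.complexConj L) 3 H) (F i)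
        (y * cmArchSection L ι H T hT (BallForms.expP b') * cmArchSection L ι H T hT u) ∂ν) 0 b) =ᵐ[μ]
      ((fderiv ℝ (fun b' : Fin 2 → ℂ ↦ (adelicGroupData (↥(maximalRealSubfield L)) L (IsCMField.complexConj L) 3 H).rightRegular μ (cmArchSection L ι H T hT (BallForms.expP b')) (w j)) 0 b :
        (adelicGroupData (↥(maximalRealSubfield L)) L (IsCMField.complexConj L) 3 H).L2 μ) : (adelicGroupData (↥(maximalRealSubfield L)) L (IsCMField.complexConj L) 3 H).automorphicQuotient → ℂ) := by
  have hι : Continuous (cmArchSection L ι H T hT) := continuous_archSectionU21CM L ι H T hT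
  -- the pointwise side is the explicit sum of orbital integrals against the derivative kernels, which is left-invariant
  have hpt : (fun y ↦ fderiv ℝ (fun b' : Fin 2 → ℂ ↦ ∑ i : Fin 2, ∫ u, A u j i * invQuot (adelicGroupData (↥(maximalRealSubfield L)) L (IsCMField.complexConj L) 3 H) (F i)
        (y * cmArchSection L ι H T hT (BallForms.expP b') * cmArchSection L ι H T hT u) ∂ν) 0 b) =
      fun y ↦ ∑ i : Fin 2, ∫ u, fderiv ℝ (fun b' : Fin 2 → ℂ ↦ A ((BallForms.expP b')⁻¹ * u) j i) 0 b *
        invQuot (adelicGroupData (↥(maximalRealSubfield L)) L (IsCMField.complexConj L) 3 H) (F i) (y * cmArchSection L ι H T hT u) ∂ν :=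
    funext fun y ↦ fderiv_probe_psi_apply L ι H T hT ν A F j hAc hAs hAd hAD hgood y 0 b
  have hleft : ∀ γ ∈ (adelicGroupData (↥(maximalRealSubfield L)) L (IsCMField.complexConj L) 3 H).quotientSubgroup, ∀ x,
      (fun y ↦ ∑ i : Fin 2, ∫ u, fderiv ℝ (fun b' : Fin 2 → ℂ ↦ A ((BallForms.expP b')⁻¹ * u) j i) 0 b *
        invQuot (adelicGroupData (↥(maximalRealSubfield L)) L (IsCMField.complexConj L) 3 H) (F i) (y * cmArchSection L ι H T hT u) ∂ν) (γ * x) =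
      (fun y ↦ ∑ i : Fin 2, ∫ u, fderiv ℝ (fun b' : Fin 2 → ℂ ↦ A ((BallForms.expP b')⁻¹ * u) j i) 0 b *
        invQuot (adelicGroupData (↥(maximalRealSubfield L)) L (IsCMField.complexConj L) 3 H) (F i) (y * cmArchSection L ι H T hT u) ∂ν) x :=
    fun γ hγ x ↦ Finset.sum_congr rfl fun i _ ↦ (adelicGroupData (↥(maximalRealSubfield L)) L (IsCMField.complexConj L) 3 H).orbitalIntegral_mul_left ν _ (F i) hγ x
  -- the `L²` side is the sum of the smoothed classes
  set S : Fin 2 → (adelicGroupData (↥(maximalRealSubfield L)) L (IsCMField.complexConj L) 3 H).L2 μ := fun i ↦ ∫ u, fderiv ℝ (fun b' : Fin 2 → ℂ ↦ A ((BallForms.expP b')⁻¹ * u) j i) 0 b •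
    (adelicGroupData (↥(maximalRealSubfield L)) L (IsCMField.complexConj L) 3 H).rightRegular μ (cmArchSection L ι H T hT u) (w i) ∂ν with hS
  have hL2 : (fderiv ℝ (fun b' : Fin 2 → ℂ ↦ (adelicGroupData (↥(maximalRealSubfield L)) L (IsCMField.complexConj L) 3 H).rightRegular μ (cmArchSection L ι H T hT (BallForms.expP b')) (w j)) 0 b) =
      S 0 + S 1 := by
    rw [fderiv_orbit_apply L ι H T hT μ ν A j hAc hAs hAd hAD w hrep b, Fin.sum_univ_two]
  have hcls : ∀ i : Fin 2, ∀ᵐ y ∂μ, ∀ g : (adelicGroupData (↥(maximalRealSubfield L)) L (IsCMField.complexConj L) 3 H).Adelic, (adelicGroupData (↥(maximalRealSubfield L)) L (IsCMField.complexConj L) 3 H).toAutomorphicQuotient g = y →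
      ((S i : (adelicGroupData (↥(maximalRealSubfield L)) L (IsCMField.complexConj L) 3 H).L2 μ) : (adelicGroupData (↥(maximalRealSubfield L)) L (IsCMField.complexConj L) 3 H).automorphicQuotient → ℂ) y =
        ∫ u, fderiv ℝ (fun b' : Fin 2 → ℂ ↦ A ((BallForms.expP b')⁻¹ * u) j i) 0 b *
          invQuot (adelicGroupData (↥(maximalRealSubfield L)) L (IsCMField.complexConj L) 3 H) (F i) (g⁻¹ * cmArchSection L ι H T hT u) ∂ν := by
    intro i
    have h := (adelicGroupData (↥(maximalRealSubfield L)) L (IsCMField.complexConj L) 3 H).coeFn_integral_smul_rightRegular_toLp_eq_orbitalIntegral μ ν hι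
      (continuous_fderiv_comp_expP_inv_mul_apply (α := fun u ↦ A u j i) (hAd j i) (hAD j i) 0 b)
      (hasCompactSupport_fderiv_comp_expP_inv_mul_apply (α := fun u ↦ A u j i) (hasCompactSupport_entry hAs j i) 0 b) (hFmem i)
    rw [hFw i] at h
    exact h
  rw [hpt, hL2]
  filter_upwards [hcls 0, hcls 1, Lp.coeFn_add (S 0) (S 1)] with y h0 h1 hadd
  obtain ⟨g, rfl⟩ : ∃ g, (adelicGroupData (↥(maximalRealSubfield L)) L (IsCMField.complexConj L) 3 H).toAutomorphicQuotient g = y := QuotientGroup.mk_surjective y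
  rw [toQuotFun_mk hleft g, hadd, Pi.add_apply, h0 g rfl, h1 g rfl, Fin.sum_univ_two]

end Assembly

/-! ## §4 STUB (R) — the registered statement with the Lines-local bundles unfolded -/

/-- **STUB (R) `stub_R_regularOfReproduced` — REGULARITY OF REPRODUCED CLASSES** (the registered `StubRRegularOfReproduced` of
`Lines/F0_P2SpectralProjectionD.lean` with the Lines-local bundles `IsRegularKernel` (four hypotheses `hAc hAs hAd hAD`), `kernelOp` (the
reproduction hypothesis `hrep`), `probeP`, `orbitP` and `Realises` (the six conjuncts of the conclusion, in the order `leftInv, cont, aeEq,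
diff, contDeriv, derivAe`) UNFOLDED — a `Theorems/` file cannot import a `Cruxes/…/Lines/` module).  In the engine setting (`L` CM,
`[L⁺:ℚ] ≥ 2`, `H` of signature `(2,1)` at `ι` with frame `T`, positive definite elsewhere, `μ` automorphic, `ν` Haar on `U(2,1)`): a
`K_c K_f`-invariant pair of `L²` classes `w` reproduced by a regular kernel, `w_j = Σ_i ∫ A(u)_{ji} • R(ιinf u) w_i dν(u)`, has representatives
`Ψ_j(x) := Σ_i ∫ A(u)_{ji} w̄_i(x ιinf(u)) dν(u)` (`w̄_i` an EXACTLY `K_c K_f`-invariant version of `w_i`, §1) that are left-invariant (R1),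
CONTINUOUS on `U(H)(𝔸)` (R2: every base point is good, §2, and the product structure `x = ιinf(U x) · k · (1, x_f)`), represent `w_j` (R3),
have differentiable `𝔭`-probes at every base point (R4) with probe derivatives continuous in the base point (R5) and REPRESENTING the
`L²`-derivatives of the `𝔭`-orbit map of `w_j` (R6).  Registrar's fold:
`stub_R_regularOfReproduced := fun L _ _ _ ι H T hT hdef hrk μ _ ν _ A hA w hrep hkc hkf => by
  obtain ⟨Ψ, h⟩ := F0P2dStubR.stubR_holds L ι H T hT hdef hrk μ ν A hA.cont hA.supp hA.diff hA.contDeriv w hrep hkc hkf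
  exact ⟨Ψ, fun j => ⟨(h j).1, (h j).2.1, (h j).2.2.1, (h j).2.2.2.1, (h j).2.2.2.2.1, (h j).2.2.2.2.2⟩⟩`.
[cite: Borel1997, Thm. 2.13 and §8.4] [cite: HarishChandra1966, §8] [cite: BorelJacquet1979, §4.1–4.2] -/
theorem stubR_holds (L : Type) [Field L] [NumberField L] [IsCMField L] (ι : L →+* ℂ) (H : Matrix (Fin 3) (Fin 3) L) (T : GL (Fin 3) ℂ)
    (hT : (T : Matrix (Fin 3) (Fin 3) ℂ)ᴴ * H.map ι * (T : Matrix (Fin 3) (Fin 3) ℂ) = Literature.Geometry.ComplexHyperbolic.BallModel.J)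
    (hdef : ∀ τ' : L →+* ℂ, InfinitePlace.mk τ' ≠ InfinitePlace.mk ι → (H.map τ').PosDef)
    (_hrk : 2 ≤ Module.finrank ℚ ↥(maximalRealSubfield L))
    (μ : Measure (adelicGroupData (↥(maximalRealSubfield L)) L (IsCMField.complexConj L) 3 H).automorphicQuotient)
    [(adelicGroupData (↥(maximalRealSubfield L)) L (IsCMField.complexConj L) 3 H).IsAutomorphicMeasure μ]
    (ν : Measure U21) [ν.IsHaarMeasure] (A : U21 → Matrix (Fin 2) (Fin 2) ℂ)
    (hAc : Continuous A) (hAs : HasCompactSupport A)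
    (hAd : ∀ (j i : Fin 2) (u' : U21), ContDiff ℝ 1 fun b : Fin 2 → ℂ ↦ A (BallForms.expP b * u') j i)
    (hAD : ∀ j i : Fin 2, Continuous fun p : (Fin 2 → ℂ) × U21 ↦ fderiv ℝ (fun b : Fin 2 → ℂ ↦ A (BallForms.expP b * p.2) j i) p.1)
    (w : Fin 2 → (adelicGroupData (↥(maximalRealSubfield L)) L (IsCMField.complexConj L) 3 H).L2 μ)
    (hrep : ∀ j : Fin 2, (∑ i : Fin 2, ∫ u, A u j i •
      (adelicGroupData (↥(maximalRealSubfield L)) L (IsCMField.complexConj L) 3 H).rightRegular μ (cmArchSection L ι H T hT u) (w i) ∂ν) = w j)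
    (hkc : ∀ k ∈ cmCompactFactor L ι H T hT, ∀ j,
      (adelicGroupData (↥(maximalRealSubfield L)) L (IsCMField.complexConj L) 3 H).rightRegular μ k (w j) = w j)
    (hkf : ∃ Kf : Subgroup (finAdelic (↥(maximalRealSubfield L)) L (IsCMField.complexConj L) 3 H),
      IsOpen (Kf : Set (finAdelic (↥(maximalRealSubfield L)) L (IsCMField.complexConj L) 3 H)) ∧
        ∀ k ∈ Kf, ∀ j, (adelicGroupData (↥(maximalRealSubfield L)) L (IsCMField.complexConj L) 3 H).rightRegular μ
          (finAdelicToAdelic (↥(maximalRealSubfield L)) L (IsCMField.complexConj L) 3 H k) (w j) = w j) :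
    ∃ Ψ : Fin 2 → ((adelicGroupData (↥(maximalRealSubfield L)) L (IsCMField.complexConj L) 3 H).Adelic → ℂ), ∀ j : Fin 2,
      (∀ γ ∈ (adelicGroupData (↥(maximalRealSubfield L)) L (IsCMField.complexConj L) 3 H).quotientSubgroup, ∀ x, Ψ j (γ * x) = Ψ j x) ∧
      Continuous (Ψ j) ∧
      toQuotFun (adelicGroupData (↥(maximalRealSubfield L)) L (IsCMField.complexConj L) 3 H) (Ψ j) =ᵐ[μ]
        ((w j : (adelicGroupData (↥(maximalRealSubfield L)) L (IsCMField.complexConj L) 3 H).L2 μ) :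
          (adelicGroupData (↥(maximalRealSubfield L)) L (IsCMField.complexConj L) 3 H).automorphicQuotient → ℂ) ∧
      (∀ y, DifferentiableAt ℝ (fun b : Fin 2 → ℂ ↦ Ψ j (y * cmArchSection L ι H T hT (BallForms.expP b))) 0) ∧
      (∀ b : Fin 2 → ℂ, Continuous fun y ↦ fderiv ℝ (fun b : Fin 2 → ℂ ↦ Ψ j (y * cmArchSection L ι H T hT (BallForms.expP b))) 0 b) ∧
      (∀ b : Fin 2 → ℂ,
        toQuotFun (adelicGroupData (↥(maximalRealSubfield L)) L (IsCMField.complexConj L) 3 H)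
            (fun y ↦ fderiv ℝ (fun b : Fin 2 → ℂ ↦ Ψ j (y * cmArchSection L ι H T hT (BallForms.expP b))) 0 b) =ᵐ[μ]
          ((fderiv ℝ (fun b : Fin 2 → ℂ ↦ (adelicGroupData (↥(maximalRealSubfield L)) L (IsCMField.complexConj L) 3 H).rightRegular μ
              (cmArchSection L ι H T hT (BallForms.expP b)) (w j)) 0 b :
              (adelicGroupData (↥(maximalRealSubfield L)) L (IsCMField.complexConj L) 3 H).L2 μ) :
            (adelicGroupData (↥(maximalRealSubfield L)) L (IsCMField.complexConj L) 3 H).automorphicQuotient → ℂ)) := by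
  obtain ⟨Kf, hKfo, hKf⟩ := hkf
  -- shrink the open `K_f` to a compact open one
  set Kf' : Subgroup (finAdelic (↥(maximalRealSubfield L)) L (IsCMField.complexConj L) 3 H) :=
    Kf ⊓ finAdelicIntegralLevel (↥(maximalRealSubfield L)) L (IsCMField.complexConj L) 3 H with hKf'
  have hKf'o : IsOpen (Kf' : Set (finAdelic (↥(maximalRealSubfield L)) L (IsCMField.complexConj L) 3 H)) := by
    rw [hKf', Subgroup.coe_inf]
    exact hKfo.inter (isOpen_finAdelicIntegralLevel _ _ _ _ _)
  have hKf'c : IsCompact (Kf' : Set (finAdelic (↥(maximalRealSubfield L)) L (IsCMField.complexConj L) 3 H)) := by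
    rw [hKf', Subgroup.coe_inf]
    exact (isCompact_finAdelicIntegralLevel _ _ _ _ _).inter_left (Subgroup.isClosed_of_isOpen Kf hKfo)
  have hKf'w : ∀ k ∈ Kf', ∀ j,
      (adelicGroupData (↥(maximalRealSubfield L)) L (IsCMField.complexConj L) 3 H).rightRegular μ
        (finAdelicToAdelic (↥(maximalRealSubfield L)) L (IsCMField.complexConj L) 3 H k) (w j) = w j :=
    fun k hk j ↦ hKf k (Subgroup.mem_inf.1 hk).1 j
  -- exactly invariant representatives
  have hex : ∀ i : Fin 2, ∃ F : (adelicGroupData (↥(maximalRealSubfield L)) L (IsCMField.complexConj L) 3 H).automorphicQuotient → ℂ,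
      StronglyMeasurable F ∧ (∃ hF : MemLp F 2 μ, hF.toLp F = w i) ∧
        (∀ k ∈ cmCompactFactor L ι H T hT, ∀ ξ, F (k • ξ) = F ξ) ∧
        (∀ k ∈ Kf', ∀ ξ, F (finAdelicToAdelic (↥(maximalRealSubfield L)) L (IsCMField.complexConj L) 3 H k • ξ) = F ξ) :=
    fun i ↦ exists_invariant_representative L ι H T hT hdef μ Kf' hKf'c (w i) (fun k hk ↦ hkc k hk i) (fun k hk ↦ hKf'w k hk i)
  choose F hFm hFex hFc hFf using hex
  have hFmem : ∀ i, MemLp (F i) 2 μ := fun i ↦ (hFex i).choose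
  have hFw : ∀ i, (hFmem i).toLp (F i) = w i := fun i ↦ (hFex i).choose_spec
  have hFi : ∀ i, Integrable (F i) μ := fun i ↦ (hFmem i).integrable one_le_two
  have hgood : ∀ (i : Fin 2) (x : (adelicGroupData (↥(maximalRealSubfield L)) L (IsCMField.complexConj L) 3 H).Adelic),
      LocallyIntegrable (fun u : U21 ↦ invQuot (adelicGroupData (↥(maximalRealSubfield L)) L (IsCMField.complexConj L) 3 H) (F i)
        (x * cmArchSection L ι H T hT u)) ν := fun i x ↦
    locallyIntegrable_orbitFun_of_invariant' L ι H T hT μ ν hKf'o (hFm i) (hFi i) (hFc i) (hFf i) x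
  refine ⟨fun j x ↦ ∑ i : Fin 2, ∫ u, A u j i *
    invQuot (adelicGroupData (↥(maximalRealSubfield L)) L (IsCMField.complexConj L) 3 H) (F i) (x * cmArchSection L ι H T hT u) ∂ν,
    fun j ↦ ⟨?_, ?_, ?_, ?_, ?_, ?_⟩⟩
  · exact fun γ hγ x ↦ psi_mul_left L ι H T hT ν A F j hγ x
  · exact continuous_psi L ι H T hT ν A F j hAc hAs hKf'o hgood hFc hFf
  · exact toQuotFun_psi_ae_eq L ι H T hT μ ν A F j hAc hAs w hFmem hFw (hrep j)
  · exact fun y ↦ (hasFDerivAt_probe_psi L ι H T hT ν A F j hAc hAs hAd hAD hgood y 0).differentiableAt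
  · exact fun b ↦ continuous_fderiv_probe_psi L ι H T hT ν A F j hAc hAs hAd hAD hKf'o hgood hFc hFf b
  · exact fun b ↦ toQuotFun_fderiv_probe_psi_ae_eq L ι H T hT μ ν A F j hAc hAs hAd hAD w hFmem hFw (hrep j) hgood b

end Summit.HodgeConjecture.HodgeConjecture.Cruxes.H413.F0P2dStubR

end
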